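/-
Copyright (c) 2026 the pub-hodgecm-mathlib formalisation cell (harness21).  Prover seat hodgecm-mathlib-K2E4-p10 (g4), Track B ∕ K2-LIT, h413 =
`stmt-HodgeConjecture-24833`, line `K2_E1_TraceFormulaBeta`, campaign «EIS-RANK-ONE» rung R6h (brick (R6h-c) = queue item (q4) of the dealer K2E1-plan (g4) 2026-09-04T06:36:44Z):
the CAUCHY–SCHWARZ inequality for the Maass–Selberg brackets — the `‖W‖² ≤ a·b` input of the pole-control junction ★ `K2E1MaassSelbergPoleControl` ∕ `…CMThree`.
-/
import Summits.HodgeConjecture.HodgeConjecture.Theorems.K2E1MaassSelbergDiagonalCMThree   -- ★ p857918 (this seat): `integral_mul_conj_self_eq`; Mathlib measure theory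
import Mathlib.MeasureTheory.Function.L2Space
import HarnessLib

/-!
# K2·E1 — `K2E1MaassSelbergBracketCauchySchwarz`: CAUCHY–SCHWARZ FOR THE MAASS–SELBERG BRACKETS (`‖[Ξ₂]‖² ≤ [Ξ₁]·[Ξ₄]`, `[Ξ₁] = ↑a ≥ 0`, `[Ξ₄] = ↑b ≥ 0`)
# (campaign «EIS-RANK-ONE», rung R6h, brick (R6h-c): the `hW`∕`hB₁`∕`hB₄` inputs of the junction ★ `K2E1MaassSelbergPoleControl[CMThree]`, pure measure theory)

Track B ∕ K2-LIT, crux h413 = `stmt-HodgeConjecture-24833`, route of record `HCCMUnconditional`; cell `hodgecm-mathlib`, squad K2, ENGINE E1.  Prover seat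
`hodgecm-mathlib-K2E4-p10` (g4); queue item (q4) of the dealer K2E1-plan (g4) 2026-09-04T06:36:44Z, REPORT-FIRST 06:43Z.  THEOREMS ONLY (no `def`, no `instance`, no notation,
no named-fact hypothesis, no `sorry`); lane `--supports stmt-HodgeConjecture-24833 --as helper` (count-neutral).  Closes no socket.

THE MATHEMATICS [MoeglinWaldspurger1995, IV.2.3 and IV.3.12; Arthur1980TraceFormulaII, §4].  At the diagonal the four Maass–Selberg brackets are `[Ξᵢ] = ∫_S w·Ξᵢ dν` with the
non-negative weight `w(x) = ‖x‖` on `S = 𝓕_I ∩ {‖x‖ ≤ 1}` and `Ξ₁(t) = ∫_K |φ(tk)|²`, `Ξ₄(t) = ∫_K |φ̃(tk)|²`, `Ξ₂(t) = ∫_K φ(tk)·conj φ̃(tk)`, `Ξ₃ = conj Ξ₂`.  Two layers of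
Cauchy–Schwarz: §1 INNER (any measure space): `‖∫ f·conj g‖² ≤ (∫‖f‖²)(∫‖g‖²)` for `f, g ∈ L²` (`norm_sq_integral_mul_conj_le`; Hölder `p = q = 2` on `‖f‖, ‖g‖`), and the diagonal
value `∫ f·conj f = ↑(∫‖f‖²)` (★ `integral_mul_conj_self_eq`); §2 OUTER, weighted: if pointwise `Ξ₁ = ↑ρ₁`, `Ξ₄ = ↑ρ₄` with `ρ₁, ρ₄ ≥ 0` and `‖Ξ₂‖² ≤ ρ₁·ρ₄` on `S`, `w ≥ 0`, and
`w·ρ₁`, `w·ρ₄` are integrable on `S`, then `[Ξ₁] = ↑a`, `[Ξ₄] = ↑b` with `a = ∫_S w·ρ₁ ≥ 0`, `b = ∫_S w·ρ₄ ≥ 0` and `‖[Ξ₂]‖² ≤ a·b` (`bracket_cauchySchwarz`: `‖∫ wΞ₂‖ ≤ ∫ w‖Ξ₂‖ ≤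
∫ √(wρ₁)·√(wρ₄) ≤ (∫wρ₁)^{½}(∫wρ₄)^{½}`) — exactly the `hB₁`, `hB₄`, `hW` (and `ha`-nonnegativity, `hb`) letters of ★ `poleControl_of_fourTerm[_conj]`.
HONEST LABEL: HC_CM is proved only modulo the 7 printed citations (2 remaining named inputs: hLiu418 = `stmt-HodgeConjecture-24832`, h413 = `stmt-HodgeConjecture-24833`) until rung 0
closes; this file asserts no named fact and closes no socket.
References: [MoeglinWaldspurger1995] IV.2.3, IV.3.12 · [Arthur1980TraceFormulaII] §4.
-/

set_option autoImplicit false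
-- the mandated namespace repeats the single-problem summit's segment (`HodgeConjecture.HodgeConjecture`)
set_option linter.dupNamespace false

noncomputable section

open MeasureTheory Measure Set Filter Topology
open scoped ENNReal NNReal ComplexConjugate
open Summit.HodgeConjecture.HodgeConjecture.Cruxes.H413.K2E1MaassSelbergDiagonalCMThree (integral_mul_conj_self_eq)

namespace Summit.HodgeConjecture.HodgeConjecture.Cruxes.H413.K2E1MaassSelbergBracketCauchySchwarz

variable {X : Type*} [MeasurableSpace X]

/-! ## §1 Inner layer: Cauchy–Schwarz for `∫ f·conj g` on any measure space -/

/-- **CAUCHY–SCHWARZ FOR THE PAIRING `∫ f·conj g`** (`f, g ∈ L²(μ; ℂ)`): `‖∫ f·conj g dμ‖ ≤ (∫‖f‖² dμ)^{½}·(∫‖g‖² dμ)^{½}` — `‖∫·‖ ≤ ∫‖·‖` and Hölder with `p = q = 2`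
(Mathlib `integral_mul_norm_le_Lp_mul_Lq`). [cite: MoeglinWaldspurger1995, IV.3.12] -/
theorem norm_integral_mul_conj_le (μ : Measure X) {f g : X → ℂ} (hf : MemLp f 2 μ) (hg : MemLp g 2 μ) :
    ‖∫ x, f x * conj (g x) ∂μ‖ ≤ (∫ x, ‖f x‖ ^ 2 ∂μ) ^ (1 / 2 : ℝ) * (∫ x, ‖g x‖ ^ 2 ∂μ) ^ (1 / 2 : ℝ) := by
  have hf' : MemLp f (ENNReal.ofReal 2) μ := by rwa [ENNReal.ofReal_ofNat]
  have hg' : MemLp g (ENNReal.ofReal 2) μ := by rwa [ENNReal.ofReal_ofNat]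
  have hH := integral_mul_norm_le_Lp_mul_Lq Real.HolderConjugate.two_two hf' hg'
  simp only [Real.rpow_two] at hH
  calc ‖∫ x, f x * conj (g x) ∂μ‖ ≤ ∫ x, ‖f x * conj (g x)‖ ∂μ := norm_integral_le_integral_norm _
    _ = ∫ x, ‖f x‖ * ‖g x‖ ∂μ := by
        refine integral_congr_ae (ae_of_all _ fun x => ?_)
        dsimp only
        rw [norm_mul, Complex.norm_conj]
    _ ≤ _ := hH

/-- Squared form: **`‖∫ f·conj g‖² ≤ (∫‖f‖²)·(∫‖g‖²)`** for `f, g ∈ L²`. [cite: MoeglinWaldspurger1995, IV.3.12] -/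
theorem norm_sq_integral_mul_conj_le (μ : Measure X) {f g : X → ℂ} (hf : MemLp f 2 μ) (hg : MemLp g 2 μ) :
    ‖∫ x, f x * conj (g x) ∂μ‖ ^ 2 ≤ (∫ x, ‖f x‖ ^ 2 ∂μ) * (∫ x, ‖g x‖ ^ 2 ∂μ) := by
  have h := norm_integral_mul_conj_le μ hf hg
  have hA : 0 ≤ ∫ x, ‖f x‖ ^ 2 ∂μ := integral_nonneg fun _ => sq_nonneg _
  have hB : 0 ≤ ∫ x, ‖g x‖ ^ 2 ∂μ := integral_nonneg fun _ => sq_nonneg _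
  calc ‖∫ x, f x * conj (g x) ∂μ‖ ^ 2 ≤ ((∫ x, ‖f x‖ ^ 2 ∂μ) ^ (1 / 2 : ℝ) * (∫ x, ‖g x‖ ^ 2 ∂μ) ^ (1 / 2 : ℝ)) ^ 2 :=
        pow_le_pow_left₀ (norm_nonneg _) h 2
    _ = (∫ x, ‖f x‖ ^ 2 ∂μ) * (∫ x, ‖g x‖ ^ 2 ∂μ) := by
        rw [mul_pow, ← Real.rpow_natCast, ← Real.rpow_natCast, ← Real.rpow_mul hA, ← Real.rpow_mul hB]
        norm_num

/-- The diagonal pairing is the REAL number `∫‖f‖²` and it is non-negative: the `hB₁ : B₁ = ↑a`, `0 ≤ a` letters at the inner layer. [folklore] -/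
theorem integral_mul_conj_self_eq_ofReal_and_nonneg (μ : Measure X) (f : X → ℂ) :
    ∫ x, f x * conj (f x) ∂μ = ((∫ x, ‖f x‖ ^ 2 ∂μ : ℝ) : ℂ) ∧ 0 ≤ ∫ x, ‖f x‖ ^ 2 ∂μ :=
  ⟨integral_mul_conj_self_eq μ f, integral_nonneg fun _ => sq_nonneg _⟩

/-! ## §2 Outer layer: the weighted brackets `[Ξ] = ∫_S w·Ξ` -/

/-- A bracket of a pointwise-real integrand is real: `∫_S ↑w·Ξ = ↑(∫_S w·ρ)` when `Ξ = ↑ρ`. [folklore] -/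
theorem setIntegral_ofReal_mul_eq_ofReal (ν : Measure X) (S : Set X) {w ρ : X → ℝ} {Ξ : X → ℂ} (hΞ : ∀ x, Ξ x = (ρ x : ℂ)) :
    ∫ x in S, (w x : ℂ) * Ξ x ∂ν = ((∫ x in S, w x * ρ x ∂ν : ℝ) : ℂ) := by
  rw [← integral_complex_ofReal]
  refine integral_congr_ae (ae_of_all _ fun x => ?_)
  dsimp only
  rw [hΞ x, Complex.ofReal_mul]

/-- **CAUCHY–SCHWARZ FOR THE WEIGHTED BRACKETS** (the `hB₁`∕`hB₄`∕`hW` letters of the pole-control junction): on a set `S` with a weight `w ≥ 0`, if `Ξ₁ = ↑ρ₁`, `Ξ₄ = ↑ρ₄` with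
`ρ₁, ρ₄ ≥ 0`, `‖Ξ₂‖² ≤ ρ₁·ρ₄` pointwise (no measurability of `Ξ₂` needed: junk-consistent) and `w·ρ₁`, `w·ρ₄` are integrable on `S`, then with `a := ∫_S w·ρ₁`, `b := ∫_S w·ρ₄`:
`[Ξ₁] = ↑a`, `[Ξ₄] = ↑b`, `0 ≤ a`, `0 ≤ b` and **`‖[Ξ₂]‖² ≤ a·b`** (`‖∫ wΞ₂‖ ≤ ∫ w‖Ξ₂‖ ≤ ∫ √(wρ₁)·√(wρ₄) ≤ ‖√(wρ₁)‖₂·‖√(wρ₄)‖₂`).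
[cite: MoeglinWaldspurger1995, IV.2.3 and IV.3.12] [cite: Arthur1980TraceFormulaII, §4] -/
theorem bracket_cauchySchwarz (ν : Measure X) (S : Set X) {w ρ₁ ρ₄ : X → ℝ} {Ξ₁ Ξ₂ Ξ₄ : X → ℂ}
    (hw : ∀ x, 0 ≤ w x) (hρ₁ : ∀ x, 0 ≤ ρ₁ x) (hρ₄ : ∀ x, 0 ≤ ρ₄ x) (hΞ₁ : ∀ x, Ξ₁ x = (ρ₁ x : ℂ)) (hΞ₄ : ∀ x, Ξ₄ x = (ρ₄ x : ℂ))
    (hCS : ∀ x, ‖Ξ₂ x‖ ^ 2 ≤ ρ₁ x * ρ₄ x)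
    (h₁ : IntegrableOn (fun x => w x * ρ₁ x) S ν) (h₄ : IntegrableOn (fun x => w x * ρ₄ x) S ν) :
    ∫ x in S, (w x : ℂ) * Ξ₁ x ∂ν = ((∫ x in S, w x * ρ₁ x ∂ν : ℝ) : ℂ) ∧ ∫ x in S, (w x : ℂ) * Ξ₄ x ∂ν = ((∫ x in S, w x * ρ₄ x ∂ν : ℝ) : ℂ) ∧
      0 ≤ ∫ x in S, w x * ρ₁ x ∂ν ∧ 0 ≤ ∫ x in S, w x * ρ₄ x ∂ν ∧
      ‖∫ x in S, (w x : ℂ) * Ξ₂ x ∂ν‖ ^ 2 ≤ (∫ x in S, w x * ρ₁ x ∂ν) * (∫ x in S, w x * ρ₄ x ∂ν) := by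
  have ha : 0 ≤ ∫ x in S, w x * ρ₁ x ∂ν := integral_nonneg fun x => mul_nonneg (hw x) (hρ₁ x)
  have hb : 0 ≤ ∫ x in S, w x * ρ₄ x ∂ν := integral_nonneg fun x => mul_nonneg (hw x) (hρ₄ x)
  refine ⟨setIntegral_ofReal_mul_eq_ofReal ν S hΞ₁, setIntegral_ofReal_mul_eq_ofReal ν S hΞ₄, ha, hb, ?_⟩
  -- the two `L²` majorants `F = √(w ρ₁)`, `G = √(w ρ₄)`
  have hFm : AEStronglyMeasurable (fun x => Real.sqrt (w x * ρ₁ x)) (ν.restrict S) := Real.continuous_sqrt.comp_aestronglyMeasurable h₁.aestronglyMeasurable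
  have hGm : AEStronglyMeasurable (fun x => Real.sqrt (w x * ρ₄ x)) (ν.restrict S) := Real.continuous_sqrt.comp_aestronglyMeasurable h₄.aestronglyMeasurable
  have hFsq : ∀ x, Real.sqrt (w x * ρ₁ x) ^ 2 = w x * ρ₁ x := fun x => Real.sq_sqrt (mul_nonneg (hw x) (hρ₁ x))
  have hGsq : ∀ x, Real.sqrt (w x * ρ₄ x) ^ 2 = w x * ρ₄ x := fun x => Real.sq_sqrt (mul_nonneg (hw x) (hρ₄ x))
  have hF2 : MemLp (fun x => Real.sqrt (w x * ρ₁ x)) 2 (ν.restrict S) :=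
    (memLp_two_iff_integrable_sq hFm).2 (h₁.congr (ae_of_all _ fun x => (hFsq x).symm))
  have hG2 : MemLp (fun x => Real.sqrt (w x * ρ₄ x)) 2 (ν.restrict S) :=
    (memLp_two_iff_integrable_sq hGm).2 (h₄.congr (ae_of_all _ fun x => (hGsq x).symm))
  have hF2' : MemLp (fun x => Real.sqrt (w x * ρ₁ x)) (ENNReal.ofReal 2) (ν.restrict S) := by rwa [ENNReal.ofReal_ofNat]
  have hG2' : MemLp (fun x => Real.sqrt (w x * ρ₄ x)) (ENNReal.ofReal 2) (ν.restrict S) := by rwa [ENNReal.ofReal_ofNat]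
  -- Hölder `p = q = 2`
  have hH := integral_mul_le_Lp_mul_Lq_of_nonneg Real.HolderConjugate.two_two (ae_of_all _ fun _ => Real.sqrt_nonneg _) (ae_of_all _ fun _ => Real.sqrt_nonneg _) hF2' hG2'
  simp only [Real.rpow_two, hFsq, hGsq] at hH
  -- `‖∫ w Ξ₂‖ ≤ ∫ w‖Ξ₂‖ ≤ ∫ F·G`
  have hFG : Integrable (fun x => Real.sqrt (w x * ρ₁ x) * Real.sqrt (w x * ρ₄ x)) (ν.restrict S) := hF2.integrable_mul hG2
  have hpt : ∀ x, ‖(w x : ℂ) * Ξ₂ x‖ ≤ Real.sqrt (w x * ρ₁ x) * Real.sqrt (w x * ρ₄ x) := by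
    intro x
    rw [← Real.sqrt_mul (mul_nonneg (hw x) (hρ₁ x)), norm_mul, Complex.norm_real, Real.norm_of_nonneg (hw x)]
    refine (Real.le_sqrt (mul_nonneg (hw x) (norm_nonneg _)) (mul_nonneg (mul_nonneg (hw x) (hρ₁ x)) (mul_nonneg (hw x) (hρ₄ x)))).2 ?_
    calc (w x * ‖Ξ₂ x‖) ^ 2 = w x * w x * ‖Ξ₂ x‖ ^ 2 := by ring
      _ ≤ w x * w x * (ρ₁ x * ρ₄ x) := mul_le_mul_of_nonneg_left (hCS x) (mul_nonneg (hw x) (hw x))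
      _ = w x * ρ₁ x * (w x * ρ₄ x) := by ring
  have hle : ‖∫ x in S, (w x : ℂ) * Ξ₂ x ∂ν‖ ≤ ∫ x in S, Real.sqrt (w x * ρ₁ x) * Real.sqrt (w x * ρ₄ x) ∂ν :=
    (norm_integral_le_integral_norm _).trans (integral_mono_of_nonneg (ae_of_all _ fun _ => norm_nonneg _) hFG (ae_of_all _ hpt))
  calc ‖∫ x in S, (w x : ℂ) * Ξ₂ x ∂ν‖ ^ 2 ≤ (∫ x in S, Real.sqrt (w x * ρ₁ x) * Real.sqrt (w x * ρ₄ x) ∂ν) ^ 2 := pow_le_pow_left₀ (norm_nonneg _) hle 2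
    _ ≤ ((∫ x in S, w x * ρ₁ x ∂ν) ^ (1 / 2 : ℝ) * (∫ x in S, w x * ρ₄ x ∂ν) ^ (1 / 2 : ℝ)) ^ 2 :=
        pow_le_pow_left₀ (integral_nonneg fun _ => mul_nonneg (Real.sqrt_nonneg _) (Real.sqrt_nonneg _)) hH 2
    _ = (∫ x in S, w x * ρ₁ x ∂ν) * (∫ x in S, w x * ρ₄ x ∂ν) := by
        rw [mul_pow, ← Real.rpow_natCast, ← Real.rpow_natCast, ← Real.rpow_mul ha, ← Real.rpow_mul hb]
        norm_num

end Summit.HodgeConjecture.HodgeConjecture.Cruxes.H413.K2E1MaassSelbergBracketCauchySchwarz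

end
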